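import Summits.Ventures.PercRepro.S1CoreCapUncond

/-!
# PercRepro — p1's UNCONDITIONAL 4-CIRCUIT TABLE EXTENDED BY THE AVERAGING RECURSION: `s₄ ≤ 170 / 231 / 308 / 402` at
nullity `9 / 10 / 11 / 12` (p8 g6, S3)

`proofs/SUBCLAIM-S3-p8.md` §3s. p1's averaging recursion `s₄(d + 1) − ⌊4·s₄(d + 1)/(d + 6)⌋ ≤ s₄(d)`
(`S1.ncard_fourCircuits_sub_div_le`, S1CoreCapAvg) iterated from the unconditional `s₄ ≤ 122` at nullity `8`
(`S1.ncard_fourCircuits_le_one_twenty_two_uncond`, S1CoreCapUncond): `s − ⌊4s/14⌋ ≤ 122 ⟹ s ≤ 170` at nullity `9`,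
`s − ⌊4s/15⌋ ≤ 170 ⟹ s ≤ 231` at `10`, `s − ⌊4s/16⌋ ≤ 231 ⟹ s ≤ 308` at `11`, `s − ⌊4s/17⌋ ≤ 308 ⟹ s ≤ 402` at `12`
— against the 4-circuit table `235 / 315 / 411 / 525` (`fourCircuitBound`). Axioms: standard.
-/

open scoped Matroid

namespace PercRepro

namespace ThmN

open Set

variable {α : Type}

/-- **`s₄ ≤ 170` on every core of nullity 9**, unconditionally (`s − ⌊4s/14⌋ ≤ 122 ⟹ s ≤ 170`). -/
theorem ncard_fourCircuits_le_one_seventy_uncond (M : Matroid α) [M.Finite]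
    (hfree : ∀ e ∈ M.E, ∃ A ⊆ M.E \ {e}, e ∉ M.closure A ∧ e ∉ M.closure ((M.E \ {e}) \ A))
    (hd : M.E.encard = M.eRank + 9) : {C : Set α | M.IsCircuit C ∧ C.ncard = 4}.ncard ≤ 170 := by
  have h := S1.ncard_fourCircuits_sub_div_le M hfree (d := 8) hd (by norm_num)
    (fun M' _ hfree' hd' => S1.ncard_fourCircuits_le_one_twenty_two_uncond M' hfree' hd')
  omega

/-- **`s₄ ≤ 231` on every core of nullity 10**, unconditionally (`s − ⌊4s/15⌋ ≤ 170 ⟹ s ≤ 231`). -/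
theorem ncard_fourCircuits_le_two_thirty_one_uncond (M : Matroid α) [M.Finite]
    (hfree : ∀ e ∈ M.E, ∃ A ⊆ M.E \ {e}, e ∉ M.closure A ∧ e ∉ M.closure ((M.E \ {e}) \ A))
    (hd : M.E.encard = M.eRank + 10) : {C : Set α | M.IsCircuit C ∧ C.ncard = 4}.ncard ≤ 231 := by
  have h := S1.ncard_fourCircuits_sub_div_le M hfree (d := 9) hd (by norm_num)
    (fun M' _ hfree' hd' => ncard_fourCircuits_le_one_seventy_uncond M' hfree' hd')
  omega

/-- **`s₄ ≤ 308` on every core of nullity 11**, unconditionally (`s − ⌊4s/16⌋ ≤ 231 ⟹ s ≤ 308`). -/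
theorem ncard_fourCircuits_le_three_oh_eight_uncond (M : Matroid α) [M.Finite]
    (hfree : ∀ e ∈ M.E, ∃ A ⊆ M.E \ {e}, e ∉ M.closure A ∧ e ∉ M.closure ((M.E \ {e}) \ A))
    (hd : M.E.encard = M.eRank + 11) : {C : Set α | M.IsCircuit C ∧ C.ncard = 4}.ncard ≤ 308 := by
  have h := S1.ncard_fourCircuits_sub_div_le M hfree (d := 10) hd (by norm_num)
    (fun M' _ hfree' hd' => ncard_fourCircuits_le_two_thirty_one_uncond M' hfree' hd')
  omega

/-- **`s₄ ≤ 402` on every core of nullity 12**, unconditionally (`s − ⌊4s/17⌋ ≤ 308 ⟹ s ≤ 402`). -/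
theorem ncard_fourCircuits_le_four_oh_two_uncond (M : Matroid α) [M.Finite]
    (hfree : ∀ e ∈ M.E, ∃ A ⊆ M.E \ {e}, e ∉ M.closure A ∧ e ∉ M.closure ((M.E \ {e}) \ A))
    (hd : M.E.encard = M.eRank + 12) : {C : Set α | M.IsCircuit C ∧ C.ncard = 4}.ncard ≤ 402 := by
  have h := S1.ncard_fourCircuits_sub_div_le M hfree (d := 11) hd (by norm_num)
    (fun M' _ hfree' hd' => ncard_fourCircuits_le_three_oh_eight_uncond M' hfree' hd')
  omega

end ThmN

end PercRepro
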